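import Mathlib.NumberTheory.LSeries.DirichletContinuation
import Mathlib.NumberTheory.LSeries.Nonvanishing
import Mathlib.NumberTheory.EulerProduct.DirichletLSeries
import Literature.NumberTheory.LFunctions.AutomorphicGRH
import Literature.NumberTheory.LFunctions.RHWave0GRHProofs
import Literature.NumberTheory.Automorphic.GLOneStandardLTate
import Literature.NumberTheory.Automorphic.AutomorphicLFunctionFlathProofs
import Literature.NumberTheory.Automorphic.AdelicGroupDataGLOneMeasureProofs
import Literature.NumberTheory.GaloisRepresentations.HeckeCharacterRamificationProofs
import HarnessLib

/-!
# `AutomorphicGRH 1 ↔ GeneralizedRiemannHypothesis` — discharge of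
`automorphicGRH_one_iff_generalizedRiemannHypothesis`

Sibling proof file (theorems and auxiliary definitions only; no named fact, no `sorry`) of
`Literature.NumberTheory.LFunctions.AutomorphicGRH`, proving
`automorphicGRH_one_iff_generalizedRiemannHypothesis_holds`: the tree's Grand Riemann Hypothesis
for cuspidal automorphic `L`-functions of `GL_1(𝔸_ℚ)` (`AutomorphicGRH 1`: for every automorphic
measure `μ`, every cuspidal `Π ≤ L²_cusp(GL_1(𝔸_ℚ) ⧸ ℝ_{>0} GL_1(ℚ))` and every standard
`L`-function datum `D` of `Π`, every holomorphic continuation of the Euler product `D.L` to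
`{re s > 1/2} \ {1}` is zero-free on `1/2 < re s < 1`) is equivalent to the Generalised Riemann
Hypothesis for Dirichlet `L`-functions (`GeneralizedRiemannHypothesis`, rh.S02, open strip, all
moduli). Iwaniec–Kowalski, *Analytic Number Theory*, §5.7 state the Grand Riemann Hypothesis for
the `L`-functions of cuspidal automorphic representations of `GL_n`; for `n = 1` over `ℚ` these are
the Dirichlet `L`-functions of primitive characters (Tate's thesis; Neukirch, Ch. VII §6,
Prop. (6.9)), which is what this file makes precise over the tree's honest definitions.

## Proof architecture

* **Dirichlet side** (`AutomorphicGRHOne.generalizedRiemannHypothesis_iff_rightHalf`): GRH is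
  equivalent to "no primitive `L(s, χ)` vanishes for `1/2 < re s < 1`", by the reduction to
  primitive characters (`generalizedRiemannHypothesis_iff_isPrimitive`) and the reflection
  `L(s, χ) = 0 ⇒ L(1 - s, χ⁻¹) = 0` (`0 < re s < 1`) from the functional equation (Mathlib
  `DirichletCharacter.IsPrimitive.completedLFunction_one_sub`, the Gamma factor being zero-free on
  `re s > 0` and `ε(χ) ≠ 0`; Davenport ch. 9, Montgomery–Vaughan Cor. 10.8).
* **An automorphic measure on `GL_1(𝔸_ℚ) ⧸ ℝ_{>0} ℚˣ` exists** — the tree's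
  `AdelicGroupData.exists_isAutomorphicMeasure_gl_one` (`AdelicGroupDataGLOneMeasureProofs`; compact
  quotient, Borel (1963), Thm. 5.8), so `AutomorphicGRH 1` is not vacuous in `μ`.
* **The cuspidal representations `ℂ · ψ̄` of `GL_1`**
  (`exists_cuspidalAutomorphicRepGL_heckeCharacter_eq`): for a unitary automorphic character `ψ` of
  `GL_1(𝔸_K)` the line spanned by `ψ̄` in `L²` is closed, invariant (`R(g) ψ̄ = ψ(g)⁻¹ ψ̄`),
  irreducible and cuspidal (no parabolic condition for `n = 1`); with `ψ = χ⁻¹ ∘ det` its Hecke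
  character is `χ`, so every unitary Hecke character trivial on `ℝ_{>0}` is the Hecke character of
  a cuspidal `Π` of `GL_1`. Applied to the finite-order Hecke character `ψ_{χ_D}` of a Dirichlet
  character `χ_D` (`HeckeCharacter.ofDirichlet`, Neukirch VII (6.9)).
* **Finite order** (`AutomorphicGRHOne.isFiniteOrder_heckeCharacter`): the Hecke character of a
  cuspidal `Π` of `GL_1(𝔸_ℚ)` is trivial on `ℝ_{>0}` hence of finite order (`𝕀_ℚ/ℚˣℝ_{>0} ≅ ẑˣ`:
  no small subgroups of `ℂˣ`, `Rat.unitIdele`, `Rat.localRed`), so it comes from a Dirichlet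
  character (`HeckeCharacter.exists_dirichletCharacter_of_isFiniteOrder_holds`, Neukirch VII (6.9)).
* **Euler products** (`AutomorphicGRHOne.L_eq_LFunction_mul`): if `ψ_Π(ϖ_p) = χ(p)` for `p ∤ m`
  then for `re s > 1`, `D.L(s) = L(s, χ) · ∏_{v ∈ T} (1 - χ(p_v) p_v^{-s}) (1 + c_v p_v^{-s})⁻¹`
  with `T = D.S ∪ {v ∣ m}` and `P_v(X) = 1 + c_v X` the local factors of `D` (Mathlib
  `DirichletCharacter.LSeries_eulerProduct_hasProd`, reindexed along
  `Rat.HeightOneSpectrum.primesEquiv`).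
* **Assembly.** `←`: for a holomorphic `g` on `Ω = {re s > 1/2} \ {1}` agreeing with `D.L` on
  `re s > 1`, `g · ∏_T (1 + c_v p_v^{-s})` and `L(s, χ) ∏_T (1 - χ(p_v) p_v^{-s})` are holomorphic on
  the connected `Ω` (`isPreconnected_rightHalf_diff_one`) and agree near a far-right point, hence on
  `Ω` (identity theorem); under GRH the second has no zero in the strip. `→`: for primitive `χ_D`,
  apply `AutomorphicGRH 1` to a cuspidal `Π` with Hecke character `ψ_{χ_D}`, a datum with trivial
  local factors at its ramified places (`StandardLFunctionData.nonempty_holds`), and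
  `g = L(s, χ_D) · ∏_T (…)`, holomorphic on `Ω`.

## References

* H. Iwaniec, E. Kowalski, *Analytic Number Theory*, AMS Colloquium Publ. 53 (2004), §5.7
  [IwaniecKowalski2004].
* J. Tate, *Fourier analysis in number fields and Hecke's zeta-functions* (1950), in
  Cassels–Fröhlich (1967), Ch. XV [TateThesis1967].
* J. Neukirch, *Algebraic Number Theory* (1999), Ch. VI §1, Ch. VII §6 Prop. (6.9) [NeukirchANT1999].
* H. Davenport, *Multiplicative Number Theory*, ch. 5, 9, 20 [DavenportMNT1980].
* H. L. Montgomery, R. C. Vaughan, *Multiplicative Number Theory I*, §10.1 [MontgomeryVaughan2007].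
* A. Borel, *Some finiteness properties of adele groups over number fields*, Publ. Math. IHÉS 16
  (1963), §5 [Borel1963].
-/

noncomputable section

open scoped MatrixGroups NNReal
open NumberField IsDedekindDomain MeasureTheory Complex Filter Topology

/-! ## The Dirichlet side: GRH in right-half form -/

namespace Literature.NumberTheory.LFunctions

namespace AutomorphicGRHOne

section Dirichlet

open DirichletCharacter

/-- The Gamma factor `γ(s, χ)` (`Γ_ℝ(s)` or `Γ_ℝ(s + 1)`) has no zero with `re s > 0`. [folklore] -/
theorem gammaFactor_ne_zero {N : ℕ} (χ : DirichletCharacter ℂ N) {s : ℂ} (hs : 0 < s.re) :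
    gammaFactor χ s ≠ 0 := by
  rcases χ.even_or_odd with hχ | hχ
  · rw [hχ.gammaFactor_def]
    exact Gammaℝ_ne_zero_of_re_pos hs
  · rw [hχ.gammaFactor_def]
    exact Gammaℝ_ne_zero_of_re_pos (by simp only [add_re, one_re]; linarith)

/-- Primitivity passes to `χ⁻¹` (same conductor, Mathlib `conductor_inv`). [folklore] -/
theorem isPrimitive_inv {N : ℕ} {χ : DirichletCharacter ℂ N} (hχ : χ.IsPrimitive) :
    χ⁻¹.IsPrimitive := by
  unfold IsPrimitive at hχ ⊢
  rw [conductor_inv]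
  exact hχ

/-- **`ε(χ) ≠ 0`** for a primitive `χ ≠ 1`: otherwise the functional equation
`Λ(1 - s, χ) = N^{s - 1/2} ε(χ) Λ(s, χ⁻¹)` forces `Λ(·, χ) ≡ 0`, whereas `L(2, χ) ≠ 0`.
[folklore] -/
theorem rootNumber_ne_zero {N : ℕ} [NeZero N] {χ : DirichletCharacter ℂ N} (hχ : χ.IsPrimitive)
    (hχ1 : χ ≠ 1) : χ.rootNumber ≠ 0 := by
  intro h0
  have hN : N ≠ 1 := by
    rintro rfl
    exact hχ1 (level_one' χ rfl)
  have hΛ : ∀ s, completedLFunction χ s = 0 := by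
    intro s
    have := hχ.completedLFunction_one_sub (1 - s)
    rw [sub_sub_cancel, h0, mul_zero, zero_mul] at this
    exact this
  have h2 : χ.LFunction 2 = 0 := by
    rw [LFunction_eq_completed_div_gammaFactor χ 2 (Or.inr hN), hΛ, zero_div]
  exact LFunction_ne_zero_of_one_le_re χ (Or.inl hχ1) (by norm_num) h2

/-- **Reflection of zeros across the critical line.** For a primitive `χ` mod `N`, a zero `s` of
`L(s, χ)` with `0 < re s < 1` yields the zero `1 - s` of `L(s, χ⁻¹)`: `Λ = γ · L` with `γ`
zero-free on `re s > 0`, and `Λ(1 - s, χ) = N^{s-1/2} ε(χ) Λ(s, χ⁻¹)` with `ε(χ) ≠ 0` (Mathlib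
`DirichletCharacter.IsPrimitive.completedLFunction_one_sub`); for `N = 1` this is
`ζ(1 - s) = 0` (Mathlib `riemannZeta_one_sub`). Montgomery–Vaughan, Cor. 10.8; Davenport ch. 9.
[folklore] -/
theorem LFunction_inv_one_sub_eq_zero {N : ℕ} [NeZero N] {χ : DirichletCharacter ℂ N}
    (hχ : χ.IsPrimitive) {s : ℂ} (hs : χ.LFunction s = 0) (h0 : 0 < s.re) (h1 : s.re < 1) :
    χ⁻¹.LFunction (1 - s) = 0 := by
  rcases eq_or_ne N 1 with rfl | hN
  · rw [LFunction_modOne_eq] at hs ⊢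
    exact GeneralizedRH.riemannZeta_one_sub_eq_zero hs h0 h1
  · have hχ1 : χ ≠ 1 := RHWave0GRH.ne_one_of_isPrimitive hχ hN
    have hs0 : s ≠ 0 := by
      rintro rfl
      simp at h0
    have h1s0 : 1 - s ≠ 0 := by
      intro h
      have := congrArg re h
      simp only [sub_re, one_re, zero_re] at this
      linarith
    have h1s : 0 < (1 - s).re := by
      simp only [sub_re, one_re]
      linarith
    have hΛ : completedLFunction χ s = 0 := by
      have h := LFunction_eq_completed_div_gammaFactor χ s (Or.inl hs0)
      rw [hs, eq_comm, div_eq_zero_iff] at h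
      exact h.resolve_right (gammaFactor_ne_zero χ h0)
    have hfe := hχ.completedLFunction_one_sub (1 - s)
    rw [sub_sub_cancel, hΛ, eq_comm, mul_eq_zero, mul_eq_zero] at hfe
    have hΛ' : completedLFunction χ⁻¹ (1 - s) = 0 := by
      rcases hfe with (h | h) | h
      · exfalso
        rw [cpow_eq_zero_iff] at h
        exact (NeZero.ne N) (by exact_mod_cast h.1)
      · exact absurd h (rootNumber_ne_zero hχ hχ1)
      · exact h
    rw [LFunction_eq_completed_div_gammaFactor χ⁻¹ (1 - s) (Or.inl h1s0), hΛ', zero_div]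

/-- **GRH in right-half form.** The Generalised Riemann Hypothesis (`GeneralizedRiemannHypothesis`,
all Dirichlet characters, open strip) is equivalent to: no primitive `L(s, χ)` vanishes for
`1/2 < re s < 1`. (`→`: immediate. `←`: reduce to primitive characters
(`generalizedRiemannHypothesis_iff_isPrimitive`), and reflect a zero with `re s < 1/2` to the zero
`1 - s` of `L(·, χ⁻¹)`, `χ⁻¹` primitive.) Davenport ch. 9, 20; Iwaniec–Kowalski §5.7. [folklore] -/
theorem generalizedRiemannHypothesis_iff_rightHalf :
    GeneralizedRiemannHypothesis ↔
      ∀ (N : ℕ) [NeZero N] (χ : DirichletCharacter ℂ N), χ.IsPrimitive →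
        ∀ s : ℂ, 1 / 2 < s.re → s.re < 1 → χ.LFunction s ≠ 0 := by
  constructor
  · intro h N _ χ _ s h1 h2 h0
    have := h N χ s h0 (by linarith) h2
    linarith
  · intro h
    rw [generalizedRiemannHypothesis_iff_isPrimitive]
    intro N _ χ hχ s hs h0 h1
    by_contra hne
    rcases lt_or_gt_of_ne hne with hlt | hgt
    · refine h N χ⁻¹ (isPrimitive_inv hχ) (1 - s) ?_ ?_ (LFunction_inv_one_sub_eq_zero hχ hs h0 h1)
      · simp only [sub_re, one_re]
        linarith
      · simp only [sub_re, one_re]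
        linarith
    · exact h N χ hχ s hgt h1 hs

end Dirichlet

/-! ## The cuspidal automorphic representations `ℂ · ψ̄` of `GL_1` -/

section GLOne

open Literature.NumberTheory.Automorphic

/-- **Every unitary Hecke character `χ` of `K` trivial on `ℝ_{>0}` is the Hecke character of a
cuspidal automorphic representation of `GL_1(𝔸_K)`** (the case `n = 1` of the Hecke/Tate
dictionary: automorphic forms on `GL(1)` are the idele class characters; Jacquet–Langlands (1970),
§9, §12; Gelbart (1975), §2). Construction: for the unitary automorphic character
`ψ = χ⁻¹ ∘ det` of `GL_1(𝔸_K)` (`detChar`), the line `ℂ · [ψ̄]` spanned by the `L²`-class of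
`ψ̄` is closed (finite-dimensional), invariant (`R(g) [ψ̄] = ψ(g)⁻¹ [ψ̄]`, as
`(R(g) φ)(x) = φ(g⁻¹ x)`), non-zero (`|ψ̄| = 1` and `μ` charges open sets), hence topologically
irreducible, and cuspidal (for `n = 1` every continuous `L²` function is a cusp form,
`mem_cuspidalSubspace_of_isContinuousCuspForm`); `R(x)` acts on it by `ψ(x)⁻¹ = χ(det x) = χ(x)`.
[folklore] -/
theorem exists_cuspidalAutomorphicRepGL_heckeCharacter_eq {K : Type} [Field K] [NumberField K]
    (μ : Measure (AdelicGroupData.gl 1 K).automorphicQuotient)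
    [(AdelicGroupData.gl 1 K).IsAutomorphicMeasure μ] (χ : GaloisRepresentations.HeckeCharacter K)
    (hχ : χ.IsUnitary) (hχ₀ : ∀ t, χ (posRealIdele K t) = 1) :
    ∃ P : CuspidalAutomorphicRepGL 1 K μ, P.heckeCharacter = χ := by
  -- the automorphic character `ψ = χ⁻¹ ∘ det` of `GL_1(𝔸_K)`
  have hu : χ⁻¹.IsUnitary := fun x => by
    rw [GaloisRepresentations.HeckeCharacter.inv_apply, Units.val_inv_eq_inv_val, norm_inv, hχ x,
      inv_one]
  have h0 : ∀ t, χ⁻¹ (posRealIdele K t) = 1 := fun t => by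
    rw [GaloisRepresentations.HeckeCharacter.inv_apply, hχ₀ t, inv_one]
  set ψ : (AdelicGroupData.gl 1 K).AutomorphicCharacter := detChar (n := 1) χ⁻¹ hu h0 with hψ
  -- the `L²`-class `v = [ψ̄]`
  have hmem : MemLp ψ.quotientFun 2 μ :=
    MemLp.of_bound (ψ.aestronglyMeasurable_quotientFun μ) 1
      (Eventually.of_forall fun x => (ψ.norm_quotientFun x).le)
  set v : (AdelicGroupData.gl 1 K).L2 μ := hmem.toLp ψ.quotientFun with hv
  have hvae : (v : (AdelicGroupData.gl 1 K).automorphicQuotient → ℂ) =ᵐ[μ] ψ.quotientFun :=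
    MemLp.coeFn_toLp _
  have hv0 : v ≠ 0 := by
    intro h
    haveI : Nonempty (AdelicGroupData.gl 1 K).automorphicQuotient :=
      ⟨(AdelicGroupData.gl 1 K).toAutomorphicQuotient 1⟩
    have hμ0 : μ ≠ 0 := fun hz =>
      isOpen_univ.measure_ne_zero μ Set.univ_nonempty (by simp [hz])
    have h1 : ψ.quotientFun =ᵐ[μ] 0 := hvae.symm.trans (Lp.eq_zero_iff_ae_eq_zero.mp h)
    haveI : (ae μ).NeBot := ae_neBot.mpr hμ0
    obtain ⟨x, hx⟩ := h1.exists
    exact ψ.quotientFun_ne_zero x hx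
  -- `v` is an eigenvector of the regular representation: `R(g) v = ψ(g)⁻¹ v`
  have hR : ∀ g : (AdelicGroupData.gl 1 K).Adelic,
      (AdelicGroupData.gl 1 K).rightRegular μ g v = ((ψ g : ℂˣ) : ℂ)⁻¹ • v := by
    intro g
    refine Lp.ext ?_
    refine ((AdelicGroupData.gl 1 K).rightRegular_apply_coeFn μ g v).trans ?_
    refine EventuallyEq.trans ?_ (Lp.coeFn_smul _ _).symm
    have h1 : (fun x => (v : (AdelicGroupData.gl 1 K).automorphicQuotient → ℂ) (g⁻¹ • x)) =ᵐ[μ]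
        fun x => ψ.quotientFun (g⁻¹ • x) :=
      (measurePreserving_smul g⁻¹ μ).quasiMeasurePreserving.ae_eq_comp hvae
    refine h1.trans ?_
    filter_upwards [hvae] with x hx
    rw [Pi.smul_apply, hx, ψ.quotientFun_smul, map_inv, Units.val_inv_eq_inv_val, smul_eq_mul]
  -- the closed invariant line `W = ℂ · v`
  let W : ContRepresentation.ClosedSubrep ((AdelicGroupData.gl 1 K).rightRegular μ) :=
    { toSubmodule := ℂ ∙ v
      apply_mem_toSubmodule := fun g f hf => by
        obtain ⟨a, rfl⟩ := Submodule.mem_span_singleton.mp hf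
        change (AdelicGroupData.gl 1 K).rightRegular μ g (a • v) ∈ ℂ ∙ v
        rw [map_smul, hR g, smul_smul]
        exact Submodule.smul_mem _ _ (Submodule.mem_span_singleton_self _)
      isClosed' := Submodule.closed_of_finiteDimensional _ }
  have hvW : v ∈ W := Submodule.mem_span_singleton_self _
  -- `W ≤ L²_cusp` (no parabolic condition for `n = 1`)
  have hWle : W ≤ cuspidalSubspace 1 K μ := by
    intro f hf
    have hφ : IsContinuousCuspForm 1 K μ ψ.quotientFun :=
      ⟨ψ.continuous_quotientFun, hmem, fun k hk hk1 => by omega⟩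
    have hv' : v ∈ (cuspidalSubspace 1 K μ).toSubmodule :=
      mem_cuspidalSubspace_of_isContinuousCuspForm hφ
    exact (Submodule.span_le.mpr (Set.singleton_subset_iff.mpr hv')) hf
  -- `W` is topologically irreducible (one-dimensional and non-zero)
  have hWirr : W.toContRep.IsTopIrreducible := by
    have hdim : Module.finrank ℂ W.toSubmodule = 1 := finrank_span_singleton hv0
    haveI hs : IsSimpleModule ℂ W.toSubmodule := isSimpleModule_iff_finrank_eq_one.2 hdim
    rw [ContRepresentation.isTopIrreducible_iff]
    refine ⟨⟨⟨⟨v, hvW⟩, 0, fun h => hv0 (congrArg Subtype.val h)⟩⟩, fun W' => ?_⟩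
    rcases hs.eq_bot_or_eq_top W'.toSubmodule with h | h
    · left
      refine ContRepresentation.ClosedSubrep.ext fun u => ?_
      rw [ContRepresentation.ClosedSubrep.mem_bot, ← ContRepresentation.ClosedSubrep.mem_toSubmodule,
        h, Submodule.mem_bot]
    · right
      refine ContRepresentation.ClosedSubrep.ext fun u => ?_
      rw [← ContRepresentation.ClosedSubrep.mem_toSubmodule, h]
      exact ⟨fun _ => ContRepresentation.ClosedSubrep.mem_top u, fun _ => Submodule.mem_top⟩
  -- the cuspidal representation and its Hecke character
  let P : CuspidalAutomorphicRepGL 1 K μ := ⟨W, hWle, hWirr⟩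
  refine ⟨P, GaloisRepresentations.HeckeCharacter.ext fun x => ?_⟩
  set f : P.1.toSubmodule := ⟨v, hvW⟩ with hf
  have h1 := P.toContRep_scalar_apply x f
  have h2 : (((P.1.toContRep (Matrix.GeneralLinearGroup.scalar (Fin 1) x) f : P.1.toSubmodule) :
      (AdelicGroupData.gl 1 K).L2 μ)) =
      ((ψ (Matrix.GeneralLinearGroup.scalar (Fin 1) x) : ℂˣ) : ℂ)⁻¹ • v := hR _
  rw [h1] at h2
  have h3 : P.heckeCharacter x = (ψ (Matrix.GeneralLinearGroup.scalar (Fin 1) x))⁻¹ := by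
    refine Units.ext ?_
    rw [Units.val_inv_eq_inv_val]
    exact smul_left_injective ℂ hv0 h2
  rw [h3, hψ, detChar_apply]
  change (χ⁻¹ (Matrix.GeneralLinearGroup.det (Matrix.GeneralLinearGroup.scalar (Fin 1) x)))⁻¹ = χ x
  rw [Matrix.GeneralLinearGroup.det_scalar, Fintype.card_fin, pow_one,
    GaloisRepresentations.HeckeCharacter.inv_apply, inv_inv]

end GLOne

/-! ## Finite order of the Hecke characters of cuspidal `Π` of `GL_1(𝔸_ℚ)` -/

section FiniteOrder

open Literature.NumberTheory.GaloisRepresentations Literature.NumberTheory.Automorphic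
  Rat.HeightOneSpectrum

/-! ### Finite order of the idele class characters of `ℚ` trivial on `ℝ_{>0}` -/

/-- The diagonal real embedding `ℝ → ℚ_∞` of `AdelicGroupData` agrees with the inverse of
`ℚ_w ≃ ℝ` at the (unique, real) infinite place `w` of `ℚ`. [folklore] -/
theorem realToInfiniteAdele_rat_apply (x : ℝ) (w : InfinitePlace ℚ) :
    realToInfiniteAdele ℚ x w = (Rat.completionRealEquiv w).symm x := by
  suffices h : realToInfiniteAdele ℚ x = fun w => (Rat.completionRealEquiv w).symm x by
    rw [h]
  change (InfiniteAdeleRing.ringEquiv_mixedSpace ℚ).symm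
    (algebraMap ℝ (mixedEmbedding.mixedSpace ℚ) x) = _
  rw [RingEquiv.symm_apply_eq]
  haveI : IsEmpty {w : InfinitePlace ℚ // w.IsComplex} :=
    ⟨fun w => (InfinitePlace.not_isReal_iff_isComplex.mpr w.2) (Rat.isReal_infinitePlace' w.1)⟩
  refine Prod.ext (funext fun v => ?_) (Subsingleton.elim _ _)
  change algebraMap ℝ ({w : InfinitePlace ℚ // w.IsReal} → ℝ) x v =
    InfinitePlace.Completion.extensionEmbeddingOfIsReal v.2
      ((InfinitePlace.Completion.ringEquivRealOfIsReal v.2).symm x)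
  rw [Pi.algebraMap_apply, Algebra.algebraMap_self, RingHom.id_apply,
    ← InfinitePlace.Completion.ringEquivRealOfIsReal_apply, RingEquiv.apply_symm_apply]

/-- **The infinite idele of a positive real is the `A_G`-idele of `AdelicGroupData`**:
`Rat.infIdele t = posRealIdele ℚ t` for `t > 0`. [folklore] -/
theorem infIdele_eq_posRealIdele (r : ℝ≥0ˣ) :
    Rat.infIdele (Units.map NNReal.toRealHom.toMonoidHom r) = posRealIdele ℚ r := by
  refine Units.ext (Prod.ext (funext fun w => ?_) ?_)
  · rw [Rat.infIdele_fst_apply, posRealIdele_fst, realToInfiniteAdele_rat_apply]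
    rfl
  · rfl

/-- The congruence condition `x_v ≡ 1 (mod 𝔭_v^k)` for a `v`-unit idele component is detected by
the local reduction map `Rat.localRed v k` (converse of
`Rat.localRed_eq_one_of_valued_sub_one_le`: the kernel of `ℤ_p → ℤ/p^k` is `p^k ℤ_p`). [folklore] -/
theorem valued_sub_one_le_of_localRed_eq_one (v : HeightOneSpectrum (𝓞 ℚ)) (k : ℕ)
    {x : ideleGroup ℚ} (h1 : Valued.v ((x : AdeleRing (𝓞 ℚ) ℚ).2 v) = 1)
    (h : Rat.localRed v k x = 1) :
    Valued.v ((x : AdeleRing (𝓞 ℚ) ℚ).2 v - 1) ≤ WithZero.exp (-(k : ℤ)) := by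
  haveI := Rat.fact_prime_natGenerator v
  have h' : (Rat.localRed v k x : ZMod (natGenerator v ^ k)) = 1 := by rw [h, Units.val_one]
  rw [Rat.val_localRed, ← sub_eq_zero, ← (PadicInt.toZModPow k).map_one, ← map_sub,
    ← RingHom.mem_ker, PadicInt.ker_toZModPow, ← PadicInt.norm_le_pow_iff_mem_span_pow,
    PadicInt.norm_def, PadicInt.coe_sub, Rat.coe_padicUnitPart_of_valued_eq_one v x h1,
    PadicInt.coe_one, Rat.padicComp_apply, ← (Rat.toPadic v).map_one, ← map_sub] at h'
  exact (Rat.valued_le_iff_norm_toPadic_le v _ k).2 h'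

/-- **A Hecke character of `ℚ` trivial on `ℝ_{>0}` has finite order** (`𝕀_ℚ / ℚˣ ℝ_{>0} ≅ ẑˣ`
is profinite). Proof: by continuity and "no small subgroups of `ℂˣ`"
(`HeckeCharacter.eq_one_of_norm_pow_sub_one_le`) `ψ` kills a congruence subgroup
`I_f^𝔪 = {x_∞ = 1, x_v ∈ 𝒪_vˣ, x_v ≡ 1 (𝔭_v^{e_v}), v ∈ T}` (`ideleGroup_exists_congruenceSubgroup_subset`);
with `x = u(x) · (r(x))`, `u(x) ∈ ℝ_{>0} × ∏_p ℤ_pˣ` (`Rat.unitIdele`), `ψ(x) = ψ(u(x)_f)` and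
`u(x)_f^N ∈ I_f^𝔪` for `N = ∏_{v ∈ T} φ(p_v^{e_v})`, so `ψ^N = 1`.
Neukirch, *Algebraic Number Theory*, Ch. VI §1, Prop. (1.9)–(1.10); Ch. VII §6, (6.9). [folklore] -/
theorem isFiniteOrder_of_map_posRealIdele (ψ : HeckeCharacter ℚ)
    (hψ : ∀ r : ℝ≥0ˣ, ψ (posRealIdele ℚ r) = 1) : ψ.IsFiniteOrder := by
  classical
  -- Step 1: a module of definition, from continuity and no small subgroups of `ℂˣ`
  have hU : {x : ideleGroup ℚ | ‖(ψ x : ℂ) - 1‖ < 1 / 2} ∈ 𝓝 (1 : ideleGroup ℚ) := by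
    have hc : Continuous fun x : ideleGroup ℚ => ‖(ψ x : ℂ) - 1‖ := by fun_prop
    refine (isOpen_lt hc continuous_const).mem_nhds ?_
    simp
  obtain ⟨T₀, hT₀, e, hTe⟩ := ideleGroup_exists_congruenceSubgroup_subset hU
  set T : Finset (HeightOneSpectrum (𝓞 ℚ)) := hT₀.toFinset with hT
  let C : ideleGroup ℚ → Prop := fun x => (x : AdeleRing (𝓞 ℚ) ℚ).1 = 1 ∧
    (∀ v, Valued.v ((x : AdeleRing (𝓞 ℚ) ℚ).2 v) = 1) ∧
    ∀ v ∈ T, Valued.v ((x : AdeleRing (𝓞 ℚ) ℚ).2 v - 1) ≤ WithZero.exp (-(e v : ℤ))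
  have h12 : ∀ v, ((1 : ideleGroup ℚ) : AdeleRing (𝓞 ℚ) ℚ).2 v = 1 := fun v => rfl
  have hC1 : C 1 := ⟨rfl, fun v => by rw [h12, map_one], fun v _ => by
    rw [h12, sub_self, map_zero]
    exact zero_le⟩
  have hCmul : ∀ x y, C x → C y → C (x * y) := by
    rintro x y ⟨hx1, hx2, hx3⟩ ⟨hy1, hy2, hy3⟩
    refine ⟨by rw [ideleGroup_val_fst_mul, hx1, hy1, mul_one], fun v => ?_, fun v hv => ?_⟩
    · rw [ideleGroup_val_snd_mul, map_mul, hx2, hy2, mul_one]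
    · rw [ideleGroup_val_snd_mul]
      have hsplit : (x : AdeleRing (𝓞 ℚ) ℚ).2 v * (y : AdeleRing (𝓞 ℚ) ℚ).2 v - 1 =
          ((x : AdeleRing (𝓞 ℚ) ℚ).2 v - 1) * (y : AdeleRing (𝓞 ℚ) ℚ).2 v +
            ((y : AdeleRing (𝓞 ℚ) ℚ).2 v - 1) := by ring
      rw [hsplit]
      refine Valuation.map_add_le _ ?_ (hy3 v hv)
      rw [map_mul, hy2, mul_one]
      exact hx3 v hv
  have hCpow : ∀ x, C x → ∀ n : ℕ, C (x ^ n) := by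
    intro x hx n
    induction n with
    | zero => simpa using hC1
    | succ n ih => rw [pow_succ]; exact hCmul _ _ ih hx
  have hmod : ∀ x, C x → ψ x = 1 := by
    intro x hx
    rw [← Units.val_eq_one]
    refine HeckeCharacter.eq_one_of_norm_pow_sub_one_le (c := 1 / 2) (by norm_num) fun n => ?_
    have h := hTe (x ^ n) (hCpow x hx n).1 (hCpow x hx n).2.1
      (fun v hv => (hCpow x hx n).2.2 v (hT₀.mem_toFinset.2 hv))
    rw [Set.mem_setOf_eq, map_pow, Units.val_pow_eq_pow_val] at h
    exact h.le
  -- Step 2: the exponent `N`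
  set N : ℕ := ∏ v ∈ T, Nat.totient (natGenerator v ^ e v) with hN
  have hN0 : 0 < N := Finset.prod_pos fun v _ =>
    Nat.totient_pos.2 (pow_pos (prime_natGenerator v).pos _)
  refine isOfFinOrder_iff_pow_eq_one.2 ⟨N, hN0, HeckeCharacter.ext fun x => ?_⟩
  rw [HeckeCharacter.pow_apply, HeckeCharacter.one_apply]
  -- decompose `x = u(x) · (r(x))`, `u = u_f · u_∞`
  have hx : x = Rat.unitIdele x * GaloisRepresentations.principalIdele ℚ (Rat.ratPart x) := by
    rw [Rat.unitIdele_apply, inv_mul_cancel_right]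
  set u := Rat.unitIdele x with hu
  have hupos : 0 < Rat.infReal u := Rat.infReal_unitIdele_pos x
  have huv : ∀ w, Valued.v ((u : AdeleRing (𝓞 ℚ) ℚ).2 w) = 1 := fun w => Rat.valued_unitIdele w x
  set t : ℝˣ := Units.mk0 (Rat.infReal u) hupos.ne' with ht
  set u' : ideleGroup ℚ := u * (Rat.infIdele t)⁻¹ with hu'
  have hu'1 : (u' : AdeleRing (𝓞 ℚ) ℚ).1 = 1 := by
    funext w
    obtain rfl : w = Rat.infinitePlace := Subsingleton.elim _ _
    rw [hu', ideleGroup_val_fst_mul, ← map_inv]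
    change (u : AdeleRing (𝓞 ℚ) ℚ).1 Rat.infinitePlace *
      (Rat.infIdele t⁻¹ : AdeleRing (𝓞 ℚ) ℚ).1 Rat.infinitePlace = 1
    rw [Rat.infIdele_fst_apply, Units.val_inv_eq_inv_val, ht, Units.val_mk0, Rat.infReal_apply,
      ← map_inv₀, RingEquiv.symm_apply_apply, mul_inv_cancel₀]
    intro h0
    apply hupos.ne'
    rw [Rat.infReal_apply, h0, map_zero]
  have hu'2 : ∀ w, (u' : AdeleRing (𝓞 ℚ) ℚ).2 w = (u : AdeleRing (𝓞 ℚ) ℚ).2 w := by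
    intro w
    rw [hu', ideleGroup_val_snd_mul, ideleGroup_val_inv_snd, Rat.infIdele_snd, inv_one, mul_one]
  -- `ψ` is trivial on `u_∞ ∈ ℝ_{>0}`
  have hψt : ψ (Rat.infIdele t) = 1 := by
    have htr : t = Units.map NNReal.toRealHom.toMonoidHom
        (Units.mk0 ⟨Rat.infReal u, hupos.le⟩ (by
          rw [Ne, ← NNReal.coe_eq_zero]
          exact hupos.ne')) := Units.ext rfl
    rw [htr, infIdele_eq_posRealIdele]
    exact hψ _
  have hψx : ψ x = ψ u' := by
    rw [hx, map_mul, ψ.map_principal (GaloisRepresentations.principalIdele_mem _), mul_one, hu', map_mul, map_inv, hψt,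
      inv_one, mul_one]
  rw [hψx, ← map_pow]
  refine hmod _ ⟨?_, fun v => ?_, fun v hv => ?_⟩
  · rw [← ideleGroup.infComp_apply, map_pow, ideleGroup.infComp_apply, hu'1, one_pow]
  · rw [← ideleGroup.finComp_apply, map_pow, ideleGroup.finComp_apply, map_pow, hu'2, huv, one_pow]
  · have hval : Valued.v (((u' ^ N : ideleGroup ℚ) : AdeleRing (𝓞 ℚ) ℚ).2 v) = 1 := by
      rw [← ideleGroup.finComp_apply, map_pow, ideleGroup.finComp_apply, map_pow, hu'2, huv,
        one_pow]
    refine valued_sub_one_le_of_localRed_eq_one v (e v) hval ?_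
    obtain ⟨c, hc⟩ : Nat.totient (natGenerator v ^ e v) ∣ N := Finset.dvd_prod_of_mem _ hv
    haveI : NeZero (natGenerator v ^ e v) := ⟨pow_ne_zero _ (prime_natGenerator v).ne_zero⟩
    rw [map_pow, hc, pow_mul, ZMod.pow_totient, one_pow]

/-- **The Hecke character of a cuspidal automorphic representation of `GL_1(𝔸_ℚ)` has finite
order**: it is trivial on `ℝ_{>0} = A_G` (`GLOne.eigenvalue_eq_one_of_mem_quotientSubgroup`).
[folklore] -/
theorem isFiniteOrder_heckeCharacter
    {μ : Measure (AdelicGroupData.gl 1 ℚ).automorphicQuotient}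
    [(AdelicGroupData.gl 1 ℚ).IsAutomorphicMeasure μ] (P : CuspidalAutomorphicRepGL 1 ℚ μ) :
    P.heckeCharacter.IsFiniteOrder := by
  refine isFiniteOrder_of_map_posRealIdele _ fun r => Units.ext ?_
  rw [CuspidalAutomorphicRepGL.heckeCharacter, GLOne.coe_heckeCharacter_apply, Units.val_one]
  exact GLOne.eigenvalue_eq_one_of_mem_quotientSubgroup P.isTopIrreducible
    ((AdelicGroupData.gl 1 ℚ).center'_le_quotientSubgroup ⟨r, rfl⟩)

end FiniteOrder

/-! ## Euler products: `D.L` against the Dirichlet `L`-function -/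

section Assembly

open Literature.NumberTheory.GaloisRepresentations Literature.NumberTheory.Automorphic
  Rat.HeightOneSpectrum

section EulerComparison

variable {μ : Measure (AdelicGroupData.gl 1 ℚ).automorphicQuotient}
  [(AdelicGroupData.gl 1 ℚ).IsAutomorphicMeasure μ] {P : CuspidalAutomorphicRepGL 1 ℚ μ}

/-- The inverse local factor of a standard `L`-function datum of `GL_1` (degree `≤ 1`, constant
term `1`) is `P_v(x) = 1 + c_v x` with `c_v` its coefficient of `X`. [folklore] -/
theorem eval_localFactor (D : StandardLFunctionData P) (v : HeightOneSpectrum (𝓞 ℚ)) (x : ℂ) :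
    (D.localFactor v).eval x = 1 + (D.localFactor v).coeff 1 * x := by
  have h := Polynomial.eq_X_add_C_of_natDegree_le_one (D.natDegree_localFactor_le v)
  have h0 : (D.localFactor v).coeff 0 = 1 := by
    rw [Polynomial.coeff_zero_eq_eval_zero, D.eval_zero_localFactor]
  conv_lhs => rw [h]
  simp only [Polynomial.eval_add, Polynomial.eval_mul, Polynomial.eval_C, Polynomial.eval_X, h0]
  ring

/-- Off `D.S` the coefficient of `X` of the local factor is `-χ_Π(ϖ_v)`, the honest Satake
parameter (`IsSatakeFamilyOf.eq_singleton_valueAtUniformizer`). [folklore] -/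
theorem coeff_localFactor_of_not_mem (D : StandardLFunctionData P) {v : HeightOneSpectrum (𝓞 ℚ)}
    (hv : v ∉ D.S) : (D.localFactor v).coeff 1 = -P.heckeCharacter.valueAtUniformizer v := by
  have h1 := eval_localFactor D v 1
  have h2 : (D.localFactor v).eval 1 = 1 - P.heckeCharacter.valueAtUniformizer v := by
    rw [D.localFactor_of_not_mem v hv,
      D.isSatakeFamily.eq_singleton_valueAtUniformizer (fun h => hv (Finset.mem_coe.mp h)),
      eval_eulerPolynomial_singleton, mul_one]
  rw [h2, mul_one, sub_eq_add_neg, add_right_inj] at h1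
  exact h1.symm

open scoped Classical in
/-- A place outside `D.S ∪ {v ∣ m}` lies over a prime not dividing `m`. [folklore] -/
theorem not_dvd_of_not_mem_union {D : StandardLFunctionData P} {m : ℕ} [NeZero m]
    {v : HeightOneSpectrum (𝓞 ℚ)}
    (hv : v ∉ D.S ∪ Finset.univ.image (Rat.placeOfFactor m)) : ¬ natGenerator v ∣ m := fun h => by
  classical
  obtain ⟨q, hq⟩ := Rat.exists_placeOfFactor_eq h
  exact hv (Finset.mem_union_right _ (Finset.mem_image.2 ⟨q, Finset.mem_univ _, hq⟩))

open scoped Classical in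
/-- **`D.L` against `L(s, χ)`.** Let `Π` be cuspidal on `GL_1(𝔸_ℚ)` with Hecke character `ψ`,
`D` a standard `L`-function datum of `Π`, and `χ` a Dirichlet character mod `m` with
`ψ(ϖ_p) = χ(p)` for all `p ∤ m`. Then for `re s > 1`,
`D.L(s) = L(s, χ) · ∏_{v ∈ T} (1 - χ(p_v) p_v^{-s}) · (1 + c_v p_v^{-s})⁻¹`, `T = D.S ∪ {v ∣ m}`,
`P_v = 1 + c_v X`: the Euler product of `D` is the Dirichlet Euler product (Mathlib
`DirichletCharacter.LSeries_eulerProduct_hasProd`, reindexed along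
`Rat.HeightOneSpectrum.primesEquiv`) corrected at the finitely many places of `T`
(Davenport ch. 5 (2)–(3): `L`-functions of characters agreeing at almost all primes differ by
finitely many Euler factors). [folklore] -/
theorem L_eq_LFunction_mul (D : StandardLFunctionData P) {m : ℕ} [NeZero m]
    (χ : DirichletCharacter ℂ m)
    (hχ : ∀ v : HeightOneSpectrum (𝓞 ℚ), ¬ natGenerator v ∣ m →
      P.heckeCharacter.valueAtUniformizer v = χ (natGenerator v))
    {s : ℂ} (hs : 1 < s.re) :
    D.L s = χ.LFunction s * ∏ v ∈ D.S ∪ Finset.univ.image (Rat.placeOfFactor m),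
      ((1 - χ (natGenerator v) * (natGenerator v : ℂ) ^ (-s)) *
        (1 + (D.localFactor v).coeff 1 * (natGenerator v : ℂ) ^ (-s))⁻¹) := by
  set T := D.S ∪ Finset.univ.image (Rat.placeOfFactor m) with hT
  set f : HeightOneSpectrum (𝓞 ℚ) → ℂ := fun v =>
    (1 + (D.localFactor v).coeff 1 * (natGenerator v : ℂ) ^ (-s))⁻¹ with hf
  set g : HeightOneSpectrum (𝓞 ℚ) → ℂ := fun v =>
    (1 - χ (natGenerator v) * (natGenerator v : ℂ) ^ (-s))⁻¹ with hg
  set h : HeightOneSpectrum (𝓞 ℚ) → ℂ := fun v => if v ∈ T then (g v)⁻¹ * f v else 1 with hh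
  have hL : D.L s = ∏' v, f v := by
    unfold StandardLFunctionData.L
    refine tprod_congr fun v => ?_
    rw [Rat.residueCard_eq_natGenerator, eval_localFactor]
  have hgprod : HasProd g (χ.LFunction s) := by
    have h1 := DirichletCharacter.LSeries_eulerProduct_hasProd χ hs
    rw [← DirichletCharacter.LFunction_eq_LSeries χ hs,
      ← (primesEquiv (R := 𝓞 ℚ)).hasProd_iff] at h1
    exact h1
  have hgne : ∀ v, g v ≠ 0 := fun v =>
    inv_ne_zero (DirichletCharacter.one_sub_mul_prime_cpow_ne_zero χ (prime_natGenerator v)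
      (by linarith))
  have hfgh : ∀ v, f v = g v * h v := by
    intro v
    by_cases hv : v ∈ T
    · rw [hh]
      simp only [if_pos hv]
      rw [← mul_assoc, mul_inv_cancel₀ (hgne v), one_mul]
    · rw [hh]
      simp only [if_neg hv, mul_one]
      rw [hf, hg]
      simp only
      rw [coeff_localFactor_of_not_mem D (fun h' => hv (Finset.mem_union_left _ h')),
        hχ v (not_dvd_of_not_mem_union (D := D) hv), neg_mul, ← sub_eq_add_neg]
  have hhprod : HasProd h (∏ v ∈ T, h v) :=
    hasProd_prod_of_ne_finset_one fun v hv => by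
      rw [hh]
      exact if_neg hv
  have hfprod : HasProd f (χ.LFunction s * ∏ v ∈ T, h v) := by
    have h2 := hgprod.mul hhprod
    convert h2 using 1
    funext v
    exact hfgh v
  rw [hL, hfprod.tprod_eq]
  congr 1
  refine Finset.prod_congr rfl fun v hv => ?_
  rw [hh]
  simp only [if_pos hv]
  rw [hg, inv_inv]

end EulerComparison

/-! ## The domain `Ω = {re s > 1/2} \ {1}` -/

/-- `Ω = {s | 1/2 < re s} \ {1}` is open. [folklore] -/
theorem isOpen_rightHalf_diff_one : IsOpen ({s : ℂ | 1 / 2 < s.re} \ {1}) :=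
  (isOpen_lt continuous_const Complex.continuous_re).sdiff isClosed_singleton

/-- `Ω` is the union of the four convex pieces `{σ > 1}`, `{σ > 1/2, t > 0}`, `{σ > 1/2, t < 0}`,
`{1/2 < σ < 1}`. [folklore] -/
theorem rightHalf_diff_one_eq_union :
    ({s : ℂ | 1 / 2 < s.re} \ {1}) =
      {s : ℂ | 1 < s.re} ∪ ({s : ℂ | 1 / 2 < s.re} ∩ {s : ℂ | 0 < s.im}) ∪
        ({s : ℂ | 1 / 2 < s.re} ∩ {s : ℂ | s.im < 0}) ∪
          ({s : ℂ | 1 / 2 < s.re} ∩ {s : ℂ | s.re < 1}) := by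
  ext s
  simp only [Set.mem_sdiff, Set.mem_setOf_eq, Set.mem_singleton_iff, Set.mem_union,
    Set.mem_inter_iff]
  constructor
  · rintro ⟨ha, h1⟩
    rcases lt_trichotomy s.re 1 with h | h | h
    · exact Or.inr ⟨ha, h⟩
    · have him : s.im ≠ 0 := fun him => h1 (Complex.ext (by simpa using h) (by simpa using him))
      rcases him.lt_or_gt with hlt | hgt
      · exact Or.inl (Or.inr ⟨ha, hlt⟩)
      · exact Or.inl (Or.inl (Or.inr ⟨ha, hgt⟩))
    · exact Or.inl (Or.inl (Or.inl h))
  · rintro (((h | ⟨ha, h⟩) | ⟨ha, h⟩) | ⟨ha, h⟩)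
    · exact ⟨by linarith, fun hs => by norm_num [hs] at h⟩
    · exact ⟨ha, fun hs => by norm_num [hs] at h⟩
    · exact ⟨ha, fun hs => by norm_num [hs] at h⟩
    · exact ⟨ha, fun hs => by norm_num [hs] at h⟩

/-- **`Ω = {s | 1/2 < re s} \ {1}` is preconnected**: consecutive convex pieces of
`rightHalf_diff_one_eq_union` overlap. [folklore] -/
theorem isPreconnected_rightHalf_diff_one : IsPreconnected ({s : ℂ | 1 / 2 < s.re} \ {1}) := by
  rw [rightHalf_diff_one_eq_union]
  have hA : IsPreconnected {s : ℂ | 1 < s.re} := (convex_halfSpace_re_gt 1).isPreconnected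
  have hB : IsPreconnected ({s : ℂ | 1 / 2 < s.re} ∩ {s : ℂ | 0 < s.im}) :=
    ((convex_halfSpace_re_gt _).inter (convex_halfSpace_im_gt 0)).isPreconnected
  have hC : IsPreconnected ({s : ℂ | 1 / 2 < s.re} ∩ {s : ℂ | s.im < 0}) :=
    ((convex_halfSpace_re_gt _).inter (convex_halfSpace_im_lt 0)).isPreconnected
  have hD : IsPreconnected ({s : ℂ | 1 / 2 < s.re} ∩ {s : ℂ | s.re < 1}) :=
    ((convex_halfSpace_re_gt _).inter (convex_halfSpace_re_lt 1)).isPreconnected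
  refine ((hA.union' ⟨2 + I, ?_⟩ hB).union' ⟨2 - I, ?_⟩ hC).union' ⟨((3 : ℝ) / 4 : ℝ) + I, ?_⟩ hD
  · simp only [Set.mem_inter_iff, Set.mem_setOf_eq, add_re, re_ofNat, I_re, add_zero, add_im,
      im_ofNat, I_im, zero_add]
    norm_num
  · simp only [Set.mem_inter_iff, Set.mem_union, Set.mem_setOf_eq, sub_re, re_ofNat, I_re,
      sub_zero, sub_im, im_ofNat, I_im, zero_sub]
    norm_num
  · simp only [Set.mem_inter_iff, Set.mem_union, Set.mem_setOf_eq, add_re, ofReal_re, I_re,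
      add_zero, add_im, ofReal_im, I_im, zero_add]
    norm_num

/-! ## `GRH ⇒ AutomorphicGRH 1` -/

/-- The Euler factor functions `z ↦ p_v^{-z}` are entire. [folklore] -/
theorem differentiable_natGenerator_cpow (v : HeightOneSpectrum (𝓞 ℚ)) :
    Differentiable ℂ fun z : ℂ => (natGenerator v : ℂ) ^ (-z) :=
  differentiable_id.neg.const_cpow (Or.inl (Nat.cast_ne_zero.2 (prime_natGenerator v).ne_zero))

/-- `‖c x‖ < 1 ⇒ 1 + c x ≠ 0`. [folklore] -/
theorem one_add_ne_zero_of_norm_lt_one {c x : ℂ} (h : ‖c * x‖ < 1) : 1 + c * x ≠ 0 := by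
  intro h0
  rw [add_eq_zero_iff_eq_neg, eq_comm, neg_eq_iff_eq_neg] at h0
  rw [h0, norm_neg, norm_one] at h
  exact lt_irrefl _ h

/-- **GRH implies the automorphic GRH for `GL_1(𝔸_ℚ)`.** Given a cuspidal `Π`, a datum `D` and a
holomorphic `g` on `Ω = {re s > 1/2} \ {1}` agreeing with `D.L` on `re s > 1`: the Hecke character
of `Π` has finite order (`isFiniteOrder_heckeCharacter`), hence matches a Dirichlet character `χ`
mod `m` at all `p ∤ m` (`HeckeCharacter.exists_dirichletCharacter_of_isFiniteOrder_holds`); by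
`L_eq_LFunction_mul`, `F = g · ∏_T (1 + c_v p_v^{-s})` and `G = L(s, χ) ∏_T (1 - χ(p_v)p_v^{-s})`
agree on a neighbourhood of the far-right point `z₀ = k + 2` (`2^k > ∑ |c_v|`), so `F = G` on the
connected `Ω` (identity theorem), and `G ≠ 0` on `1/2 < re s < 1` under GRH
(`GeneralizedRiemannHypothesis.LFunction_ne_zero`, `one_sub_mul_prime_cpow_ne_zero`).
Iwaniec–Kowalski §5.7 (GRH for `GL_1` is GRH for Dirichlet characters). [folklore] -/
theorem automorphicGRH_one_of_generalizedRiemannHypothesis (hGRH : GeneralizedRiemannHypothesis) :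
    AutomorphicGRH 1 := by
  classical
  intro μ _ P D g₀ hg₀ hagree s hs1 hs2
  obtain ⟨m, hm, χ, hχ⟩ := HeckeCharacter.exists_dirichletCharacter_of_isFiniteOrder_holds
    P.heckeCharacter (isFiniteOrder_heckeCharacter P)
  haveI := hm
  have hχ' : ∀ v : HeightOneSpectrum (𝓞 ℚ), ¬ natGenerator v ∣ m →
      P.heckeCharacter.valueAtUniformizer v = χ (natGenerator v) := by
    intro v hv
    have h := (hχ v (by rwa [Rat.natCast_mem_asIdeal_iff])).2
    rwa [Rat.residueCard_eq_natGenerator] at h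
  set T := D.S ∪ Finset.univ.image (Rat.placeOfFactor m) with hT
  set c : HeightOneSpectrum (𝓞 ℚ) → ℂ := fun v => (D.localFactor v).coeff 1 with hc
  set E : ℂ → ℂ := fun z => ∏ v ∈ T, (1 + c v * (natGenerator v : ℂ) ^ (-z)) with hE
  set G : ℂ → ℂ := fun z => χ.LFunction z *
    ∏ v ∈ T, (1 - χ (natGenerator v) * (natGenerator v : ℂ) ^ (-z)) with hG
  set F : ℂ → ℂ := fun z => g₀ z * E z with hF
  -- holomorphy on `Ω`
  have hEd : Differentiable ℂ E := Differentiable.fun_finsetProd fun v _ =>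
    (differentiable_const _).add ((differentiable_const _).mul (differentiable_natGenerator_cpow v))
  have hFd : DifferentiableOn ℂ F ({s : ℂ | 1 / 2 < s.re} \ {1}) := hg₀.mul hEd.differentiableOn
  have hGd : DifferentiableOn ℂ G ({s : ℂ | 1 / 2 < s.re} \ {1}) := by
    refine DifferentiableOn.mul (fun z hz => ?_)
      (Differentiable.fun_finsetProd fun v _ => ?_).differentiableOn
    · exact (DirichletCharacter.differentiableAt_LFunction χ z
        (Or.inl fun h => hz.2 (Set.mem_singleton_iff.2 h))).differentiableWithinAt
    · exact (differentiable_const _).sub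
        ((differentiable_const _).mul (differentiable_natGenerator_cpow v))
  -- a far-right point `z₀` where all correction factors are non-zero
  obtain ⟨k, hk⟩ := pow_unbounded_of_one_lt (∑ v ∈ T, ‖c v‖) (one_lt_two : (1 : ℝ) < 2)
  set z₀ : ℂ := (k : ℂ) + 2 with hz₀
  have hz₀re : z₀.re = k + 2 := by simp [hz₀]
  have hsmall : ∀ v ∈ T, ‖c v * (natGenerator v : ℂ) ^ (-z₀)‖ < 1 := by
    intro v hv
    have hp : (2 : ℝ) ≤ (natGenerator v : ℝ) := by exact_mod_cast (prime_natGenerator v).two_le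
    have hp0 : (0 : ℝ) < (natGenerator v : ℝ) := by linarith
    rw [norm_mul, Complex.norm_natCast_cpow_of_pos (prime_natGenerator v).pos, neg_re, hz₀re]
    have hb : ‖c v‖ < 2 ^ k :=
      (Finset.single_le_sum (fun w _ => norm_nonneg (c w)) hv).trans_lt hk
    have hpk : (2 : ℝ) ^ k ≤ (natGenerator v : ℝ) ^ ((k : ℝ) + 2) := by
      calc (2 : ℝ) ^ k ≤ 2 ^ (k + 2) := pow_le_pow_right₀ one_le_two (by omega)
        _ ≤ (natGenerator v : ℝ) ^ (k + 2) := pow_le_pow_left₀ zero_le_two hp _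
        _ = (natGenerator v : ℝ) ^ ((k : ℝ) + 2) := by
          rw [← Real.rpow_natCast]
          push_cast
          ring_nf
    rw [Real.rpow_neg hp0.le, ← div_eq_mul_inv, div_lt_one (Real.rpow_pos_of_pos hp0 _)]
    exact hb.trans_le hpk
  set U : Set ℂ := {z : ℂ | 1 < z.re} ∩
    ⋂ v ∈ T, {z : ℂ | 1 + c v * (natGenerator v : ℂ) ^ (-z) ≠ 0} with hU
  have hUo : IsOpen U := by
    refine (isOpen_lt continuous_const Complex.continuous_re).inter
      (isOpen_biInter_finset fun v _ => ?_)
    exact isOpen_ne_fun (continuous_const.add (continuous_const.mul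
      (differentiable_natGenerator_cpow v).continuous)) continuous_const
  have hz₀U : z₀ ∈ U := by
    refine ⟨?_, Set.mem_iInter₂.2 fun v hv => one_add_ne_zero_of_norm_lt_one (hsmall v hv)⟩
    change 1 < z₀.re
    rw [hz₀re]
    linarith [k.cast_nonneg (α := ℝ)]
  have hFG : ∀ z ∈ U, F z = G z := by
    rintro z ⟨hz1, hz2⟩
    have hz1' : 1 < z.re := hz1
    have hz2' : ∀ v ∈ T, 1 + c v * (natGenerator v : ℂ) ^ (-z) ≠ 0 := fun v hv =>
      Set.mem_iInter₂.1 hz2 v hv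
    rw [hF, hG, hE]
    simp only
    rw [hagree z hz1', L_eq_LFunction_mul D χ hχ' hz1', mul_assoc, ← Finset.prod_mul_distrib]
    congr 1
    refine Finset.prod_congr rfl fun v hv => ?_
    rw [mul_assoc, inv_mul_cancel₀ (hz2' v hv), mul_one]
  have hev : F =ᶠ[𝓝 z₀] G := Filter.eventuallyEq_of_mem (hUo.mem_nhds hz₀U) hFG
  have hz₀Ω : z₀ ∈ ({s : ℂ | 1 / 2 < s.re} \ {1}) := by
    refine ⟨?_, fun h => ?_⟩
    · change 1 / 2 < z₀.re
      rw [hz₀re]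
      linarith [k.cast_nonneg (α := ℝ)]
    · have h' := congrArg re (Set.mem_singleton_iff.1 h)
      rw [hz₀re, one_re] at h'
      linarith [k.cast_nonneg (α := ℝ)]
  have hEq : Set.EqOn F G ({s : ℂ | 1 / 2 < s.re} \ {1}) :=
    ((Complex.analyticOnNhd_iff_differentiableOn isOpen_rightHalf_diff_one).2
        hFd).eqOn_of_preconnected_of_eventuallyEq
      ((Complex.analyticOnNhd_iff_differentiableOn isOpen_rightHalf_diff_one).2 hGd)
      isPreconnected_rightHalf_diff_one hz₀Ω hev
  have hs1' : s ≠ 1 := by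
    rintro rfl
    rw [one_re] at hs2
    exact lt_irrefl _ hs2
  have hsΩ : s ∈ ({s : ℂ | 1 / 2 < s.re} \ {1}) := ⟨hs1, fun h => hs1' (Set.mem_singleton_iff.1 h)⟩
  have hGs : G s ≠ 0 := by
    rw [hG]
    refine mul_ne_zero (hGRH.LFunction_ne_zero χ hs1 (Or.inr hs1')) ?_
    exact Finset.prod_ne_zero_iff.2 fun v _ =>
      DirichletCharacter.one_sub_mul_prime_cpow_ne_zero χ (prime_natGenerator v) (by linarith)
  intro h0
  apply hGs
  rw [← hEq hsΩ, hF]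
  simp only
  rw [h0, zero_mul]

/-! ## `AutomorphicGRH 1 ⇒ GRH` -/

/-- **The automorphic GRH for `GL_1(𝔸_ℚ)` implies GRH.** By
`generalizedRiemannHypothesis_iff_rightHalf` it suffices to show `L(s, χ) ≠ 0` for primitive `χ`
and `1/2 < re s < 1`. Take an automorphic measure `μ` (`exists_isAutomorphicMeasure_gl_one`), a
cuspidal `Π` of `GL_1(𝔸_ℚ)` whose Hecke character is the finite-order Hecke character `ψ_χ` of
`χ` (`exists_cuspidalAutomorphicRepGL_heckeCharacter_eq`, `HeckeCharacter.ofDirichlet`), a datum `D`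
of `Π` with local factor `1` at its ramified places (from `StandardLFunctionData.nonempty_holds`),
so that all `|c_v| ≤ 1`, and `g(s) = L(s, χ) ∏_T (1 - χ(p_v)p_v^{-s})(1 + c_v p_v^{-s})⁻¹`,
holomorphic on `Ω` and equal to `D.L` on `re s > 1` (`L_eq_LFunction_mul`); `AutomorphicGRH 1`
gives `g(s) ≠ 0`, whence `L(s, χ) ≠ 0`. Iwaniec–Kowalski §5.7; Tate (1950); Neukirch VII (6.9).
[folklore] -/
theorem generalizedRiemannHypothesis_of_automorphicGRH_one (hA : AutomorphicGRH 1) :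
    GeneralizedRiemannHypothesis := by
  classical
  rw [generalizedRiemannHypothesis_iff_rightHalf]
  intro N _ χ _ s hs1 hs2
  obtain ⟨μ, hμ⟩ := AdelicGroupData.exists_isAutomorphicMeasure_gl_one ℚ
  haveI := hμ
  -- a cuspidal `Π` with Hecke character `ψ_χ`
  set χH := HeckeCharacter.ofDirichlet χ with hχH
  have hfin : χH.IsFiniteOrder := HeckeCharacter.isFiniteOrder_ofDirichlet χ
  obtain ⟨P, hPχ⟩ := exists_cuspidalAutomorphicRepGL_heckeCharacter_eq μ χH hfin.isUnitary
    fun t => HeckeCharacter.map_posRealIdele_of_isFiniteOrder hfin t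
  -- a datum with local factor `1` at the ramified places
  obtain ⟨D₀⟩ := StandardLFunctionData.nonempty_holds P
  let D : StandardLFunctionData P :=
    { S := D₀.S
      α := D₀.α
      isSatakeFamily := D₀.isSatakeFamily
      not_isUnramifiedAt := D₀.not_isUnramifiedAt
      localFactor := fun v => if v ∈ D₀.S then 1 else eulerPolynomial (D₀.α v)
      localFactor_of_not_mem := fun v hv => if_neg hv
      eval_zero_localFactor := fun v => by
        show Polynomial.eval 0 (if v ∈ D₀.S then 1 else eulerPolynomial (D₀.α v)) = 1
        split_ifs <;> simp
      natDegree_localFactor_le := fun v => by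
        show (if v ∈ D₀.S then 1 else eulerPolynomial (D₀.α v)).natDegree ≤ 1
        split_ifs with hv
        · simp
        · exact (natDegree_eulerPolynomial_le (D₀.α v)).trans
            (D₀.isSatakeFamily.card_eq (fun h => hv (Finset.mem_coe.mp h))).le }
  -- its coefficients `c_v` have norm `≤ 1`
  set c : HeightOneSpectrum (𝓞 ℚ) → ℂ := fun v => (D.localFactor v).coeff 1 with hc
  have hb : ∀ v, ‖c v‖ ≤ 1 := by
    intro v
    by_cases hv : v ∈ D₀.S
    · have h1 : c v = 0 := by
        show Polynomial.coeff (if v ∈ D₀.S then 1 else eulerPolynomial (D₀.α v)) 1 = 0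
        rw [if_pos hv, Polynomial.coeff_one]
        simp
      rw [h1, norm_zero]
      exact zero_le_one
    · have h1 : c v = -P.heckeCharacter.valueAtUniformizer v := coeff_localFactor_of_not_mem D hv
      rw [h1, norm_neg, hPχ]
      exact (HeckeCharacter.norm_valueAtUniformizer_of_isUnitary hfin.isUnitary v).le
  have hχ' : ∀ v : HeightOneSpectrum (𝓞 ℚ), ¬ natGenerator v ∣ N →
      P.heckeCharacter.valueAtUniformizer v = χ (natGenerator v) := by
    intro v hv
    rw [hPχ, hχH, HeckeCharacter.valueAtUniformizer_ofDirichlet χ hv, Rat.residueCard_eq_natGenerator]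
  set T := D.S ∪ Finset.univ.image (Rat.placeOfFactor N) with hT
  set g : ℂ → ℂ := fun z => χ.LFunction z * ∏ v ∈ T,
    ((1 - χ (natGenerator v) * (natGenerator v : ℂ) ^ (-z)) *
      (1 + c v * (natGenerator v : ℂ) ^ (-z))⁻¹) with hg
  have hne : ∀ (v : HeightOneSpectrum (𝓞 ℚ)) (z : ℂ), 0 < z.re →
      1 + c v * (natGenerator v : ℂ) ^ (-z) ≠ 0 := by
    intro v z hz
    refine one_add_ne_zero_of_norm_lt_one ?_
    rw [norm_mul, Complex.norm_natCast_cpow_of_pos (prime_natGenerator v).pos, neg_re]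
    calc ‖c v‖ * (natGenerator v : ℝ) ^ (-z.re)
        ≤ 1 * (natGenerator v : ℝ) ^ (-z.re) := by
          gcongr
          exact hb v
      _ < 1 := by
          rw [one_mul]
          exact Real.rpow_lt_one_of_one_lt_of_neg
            (by exact_mod_cast (prime_natGenerator v).one_lt) (by linarith)
  have hgd : DifferentiableOn ℂ g ({s : ℂ | 1 / 2 < s.re} \ {1}) := by
    refine DifferentiableOn.mul (fun z hz => ?_) (DifferentiableOn.fun_finsetProd fun v _ => ?_)
    · exact (DirichletCharacter.differentiableAt_LFunction χ z
        (Or.inl fun h => hz.2 (Set.mem_singleton_iff.2 h))).differentiableWithinAt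
    · refine DifferentiableOn.mul ?_ ?_
      · exact ((differentiable_const _).sub ((differentiable_const _).mul
          (differentiable_natGenerator_cpow v))).differentiableOn
      · refine DifferentiableOn.inv ?_ fun z hz => hne v z ?_
        · exact ((differentiable_const _).add ((differentiable_const _).mul
            (differentiable_natGenerator_cpow v))).differentiableOn
        · have h := hz.1
          change 1 / 2 < z.re at h
          linarith
  have hagree : ∀ z : ℂ, 1 < z.re → g z = D.L z := fun z hz => by
    rw [L_eq_LFunction_mul D χ hχ' hz]
  have key := hA μ P D g hgd hagree s hs1 hs2
  intro hL0
  apply key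
  rw [hg]
  simp only
  rw [hL0, zero_mul]

end Assembly

end AutomorphicGRHOne

/-! ## The discharge -/

/-- **`AutomorphicGRH 1 ↔ GeneralizedRiemannHypothesis`** — discharge of the named fact
`automorphicGRH_one_iff_generalizedRiemannHypothesis` (the `GL_1` sanity check of the tree's Grand
Riemann Hypothesis for cuspidal automorphic `L`-functions, Iwaniec–Kowalski, *Analytic Number
Theory*, §5.7: for `n = 1` over `ℚ` the cuspidal automorphic representations are the idele class
characters of finite order, whose `L`-functions are the Dirichlet `L`-functions of primitive
characters — Tate (1950); Neukirch, Ch. VII §6, Prop. (6.9)). The two implications are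
`AutomorphicGRHOne.automorphicGRH_one_of_generalizedRiemannHypothesis` and
`AutomorphicGRHOne.generalizedRiemannHypothesis_of_automorphicGRH_one`.
[cite: IwaniecKowalski2004, §5.7] -/
theorem automorphicGRH_one_iff_generalizedRiemannHypothesis_holds :
    automorphicGRH_one_iff_generalizedRiemannHypothesis :=
  ⟨AutomorphicGRHOne.generalizedRiemannHypothesis_of_automorphicGRH_one,
    AutomorphicGRHOne.automorphicGRH_one_of_generalizedRiemannHypothesis⟩

end Literature.NumberTheory.LFunctions
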